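import Summits.HodgeConjecture.HodgeConjecture.Theorems.Ring2WeilCoverageRamifiedTypesLevel36
import Summits.HodgeConjecture.HodgeConjecture.Theorems.Ring2WeilCoverageRealGeneratorTypes
import HarnessLib

/-!
# Weil-type family coverage — THE PRODUCT TYPE `𝔮₃𝔮₂` ON THE `ℚ(i)`-BALANCED `ℤ[ζ₃₆]`-CM TYPES EXISTS
# (`𝔬𝔣₀ = (π_Aπ_B)`, `π_A = ζ³³(1 − ζ⁴)(1 − ζ²)`, `π_B = ζ³¹(1 − ζ⁹)(1 − ζ)`, degree `24`): the type behind pub-hsemireg's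
# row R3 = `(3, ℚ(i), 3)` (part 116 computes its van Geemen class)

research route conditional on HC_CM; not a corollary; Q11.4-sentence-2 already refuted in dim ≥ 3.

Ring 2, WEIL-TYPE FAMILY-COVERAGE CENSUS (`HOME/WEIL-FAMILY-COVERAGE.md` `## b01`, block b01.41 (C) «cross-checks: … the type
`𝔮₂𝔮₃` (degree 24) on the `ℚ(i)`-balanced `ℤ[ζ₃₆]`-types = b01.17's `A′₃₆` on R3 = `(3, ℚ(i), 3)`», S-pencil there), part
115 of the `Ring2WeilCoverage*` series; a complement to part 49b (`Ring2WeilCoverageRamifiedTypesLevel36`): there the two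
ramified primes `𝔮₃ = (π_A)`, `𝔮₂ = (π_B)` of `ℚ(ζ₃₆)⁺` each FLIP the principal verdict (`N(π_A) = −3`, `N(π_B) = −8`), so
they polarise the `ℚ(√−3)`-balanced types; their PRODUCT has positive norm and polarises the SAME CM types as the
principal form — the `ℚ(i)`-balanced ones (the YES row `(36, ℚ(i))`, `N_K = {7, 11, 19, 23, 31, 35}`).

* §1 the sign dictionary of `ϖ = π_Aπ_B` (real, non-zero): `Re φ(ϖ) < 0 ↔ t ∈ {5, 7, 11, 17, 19, 25, 29, 31}` (`= A_A ∆ A_B`;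
  part 13 `re_embedding_gen` twice: a product of two non-zero reals is negative iff exactly one factor is); the twisted
  set `X = N_odd ∆ A = {1, 5, 11, 13, 17, 29}`; the reduced form `π_Aπ_B = −1 + 2ζ³ − 2ζ⁷ + 2ζ⁸ − ζ⁹ − 2ζ¹⁰ + 2ζ¹¹`.
* §2 **EXISTENCE: every `ℚ(i)`-balanced CM type `Φ` of `ℚ(ζ₃₆)` carries a `Φ`-positive divisor of type `𝔣₀`,
  `𝔬𝔣₀ = (π_Aπ_B)`** (part 53 `exists_type_of_even'` + THEOREM L (ii) at `36`; `|S_Φ ∩ X| ≡ |X ∖ N_K| + 3 = 5 + 3 ≡ 0`),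
  and such an `𝔣₀ ⊆ 𝓞 K⁺` exists.

HONEST FRAMING as parts 48–54: kernel statements about Shimura's divisors of type `(K; Φ; 𝔣₀)` on the principal CM torus
`ℂ^Φ/Φ(ℤ[ζ₃₆])` and residue combinatorics (`decide`); nothing about Hodge classes, `W_K`, general members or HC; `HC_CM`
is used nowhere.  No `def`, no named fact, no `sorry`.

References: [cite: Shimura1998, §14.3 Prop. 4–5, pp. 103–104]; [cite: Washington1997, §8.1]; census b01.16 (E), b01.17,
b01.41 (C) (seat-derived).
-/

noncomputable section

open Polynomial NumberField Complex Finset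
open scoped nonZeroDivisors

namespace Summit.HodgeConjecture.Ring2WeilCoverage.WeilGramLevel36TypeABExists

open Literature.AlgebraicGeometry.Motives (CMType)
open Literature.AlgebraicGeometry.HodgeTheory (IsCMTypeSet)
open Literature.AlgebraicGeometry.ComplexMultiplication.CyclotomicCMType (isCMTypeSet_residueFilter)
open Literature.NumberTheory.ComplexMultiplication
open Summit.HodgeConjecture.Ring2WeilCoverage.RamifiedTypes (complexConj_gen gen_ne_zero card_inter_mod_two_eq)
open Summit.HodgeConjecture.Ring2WeilCoverage.RealGeneratorTypes (exists_type_of_even' exists_ideal_map_eq_span)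
open Summit.HodgeConjecture.Ring2WeilCoverage.CyclotomicUnitProducts (re_embedding_gen)
open Summit.HodgeConjecture.Ring2WeilCoverage.CyclotomicPrincipalObstruction (coprime_of_apply_eq_toCircle)
open Summit.HodgeConjecture.Ring2WeilCoverage.CMTypeSetOddPositions (two_mul_card_eq_card_units)
open Summit.HodgeConjecture.Ring2WeilCoverage.CyclotomicSignaturesG6 (exists_units_sign_eq_thirtySix)

variable {K : Type} [Field K] [NumberField K] {ζ : K}

/-- `𝐞(t) = exp(2πi t/n) ∈ ℂ` (`ZMod.toCircle`). -/
local notation3 (prettyPrint := false) "𝐞 " t:max => ((ZMod.toCircle t : Circle) : ℂ)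

/-- the residue set `S_Φ` read at level `36`. -/
local notation3 (prettyPrint := false) "SΦ[" Φ "," z "]" =>
  (Finset.univ.filter fun t : ZMod 36 => ∃ σ ∈ (Φ : CMType K).1, σ (z : K) = 𝐞 t)

/-- part 53's twisted set `X_A` at level `36`. -/
local notation3 (prettyPrint := false) "XA36 " A:max =>
  (Finset.univ.filter fun t : ZMod 36 => t.val.Coprime 36 ∧
    ¬ (t ∈ (A : Finset (ZMod 36)) ↔ Even (Finset.card (Finset.filter (fun s : ZMod 36 => s.val.Coprime 36 ∧ s.val < t.val) Finset.univ))))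

/-! ### §1 The product `ϖ = π_Aπ_B`: sign dictionary, twisted set, reduced form -/

/-- **`ϖ = π_Aπ_B` is real, non-zero, and `Re φ(ϖ) < 0 ↔ t ∈ {5, 7, 11, 17, 19, 25, 29, 31}`** for `φ ζ = 𝐞(t)` (the
symmetric difference of the sign sets `A_A = {1,5,7,29,31,35}`, `A_B = {1,11,17,19,25,35}` of part 13's sign law
`re_embedding_gen` for `π_A = ζ³³(1 − ζ⁴)(1 − ζ²)` and `π_B = ζ³¹(1 − ζ⁹)(1 − ζ)`: a product of two non-zero reals is negative
iff exactly one factor is).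
research route conditional on HC_CM; not a corollary; Q11.4-sentence-2 already refuted in dim ≥ 3. [cite: Washington1997, §8.1] -/
theorem signSet_thirtySix_AB [IsCMField K] (hζ : IsPrimitiveRoot ζ 36) :
    (∀ (φ : K →+* ℂ) (t : ZMod 36), φ ζ = 𝐞 t →
      ((φ (ζ ^ 33 * (1 - ζ ^ 4) * (1 - ζ ^ 2) * (ζ ^ 31 * (1 - ζ ^ 9) * (1 - ζ)))).re < 0 ↔ t ∈ ({5, 7, 11, 17, 19, 25, 29, 31} : Finset (ZMod 36)))) ∧
    IsCMField.complexConj K (ζ ^ 33 * (1 - ζ ^ 4) * (1 - ζ ^ 2) * (ζ ^ 31 * (1 - ζ ^ 9) * (1 - ζ))) = ζ ^ 33 * (1 - ζ ^ 4) * (1 - ζ ^ 2) * (ζ ^ 31 * (1 - ζ ^ 9) * (1 - ζ)) ∧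
      ζ ^ 33 * (1 - ζ ^ 4) * (1 - ζ ^ 2) * (ζ ^ 31 * (1 - ζ ^ 9) * (1 - ζ)) ≠ 0 := by
  have hA : ¬ 36 ∣ ((4, 2, 33) : ℕ × ℕ × ℕ).1 ∧ ¬ 36 ∣ ((4, 2, 33) : ℕ × ℕ × ℕ).2.1 ∧
      (2 * ((4, 2, 33) : ℕ × ℕ × ℕ).2.2 + ((4, 2, 33) : ℕ × ℕ × ℕ).1 + ((4, 2, 33) : ℕ × ℕ × ℕ).2.1) % (2 * 36) = 0 := by
    decide
  have hB : ¬ 36 ∣ ((9, 1, 31) : ℕ × ℕ × ℕ).1 ∧ ¬ 36 ∣ ((9, 1, 31) : ℕ × ℕ × ℕ).2.1 ∧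
      (2 * ((9, 1, 31) : ℕ × ℕ × ℕ).2.2 + ((9, 1, 31) : ℕ × ℕ × ℕ).1 + ((9, 1, 31) : ℕ × ℕ × ℕ).2.1) % (2 * 36) = 0 := by
    decide
  have hrealA : IsCMField.complexConj K (ζ ^ 33 * (1 - ζ ^ 4) * (1 - ζ ^ 2)) = ζ ^ 33 * (1 - ζ ^ 4) * (1 - ζ ^ 2) := complexConj_gen hζ hA
  have hrealB : IsCMField.complexConj K (ζ ^ 31 * (1 - ζ ^ 9) * (1 - ζ)) = ζ ^ 31 * (1 - ζ ^ 9) * (1 - ζ) := by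
    simpa only [pow_one] using complexConj_gen hζ hB
  have h0A : (ζ ^ 33 * (1 - ζ ^ 4) * (1 - ζ ^ 2) : K) ≠ 0 := gen_ne_zero hζ hA
  have h0B : (ζ ^ 31 * (1 - ζ ^ 9) * (1 - ζ) : K) ≠ 0 := by simpa only [pow_one] using gen_ne_zero hζ hB
  refine ⟨fun φ t hφt => ?_, by rw [map_mul, hrealA, hrealB], mul_ne_zero h0A h0B⟩
  have ht := coprime_of_apply_eq_toCircle hζ hφt
  have kA := re_embedding_gen hφt ht (a := 4) (b := 2) (h := 33) (by decide) (by decide) (by decide)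
  have kB' := re_embedding_gen hφt ht (a := 9) (b := 1) (h := 31) (by decide) (by decide) (by decide)
  have kB : ((φ (ζ ^ 31 * (1 - ζ ^ 9) * (1 - ζ))).re < 0 ↔ (36 < 9 * t.val % (2 * 36) ↔ 36 < 1 * t.val % (2 * 36))) ∧
      (φ (ζ ^ 31 * (1 - ζ ^ 9) * (1 - ζ))).re ≠ 0 ∧ (φ (ζ ^ 31 * (1 - ζ ^ 9) * (1 - ζ))).im = 0 := by
    simpa only [pow_one] using kB'
  have hA0 : 0 < (φ (ζ ^ 33 * (1 - ζ ^ 4) * (1 - ζ ^ 2))).re ↔ ¬ (φ (ζ ^ 33 * (1 - ζ ^ 4) * (1 - ζ ^ 2))).re < 0 :=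
    ⟨fun h => not_lt.mpr h.le, fun h => lt_of_le_of_ne (not_lt.mp h) kA.2.1.symm⟩
  have hB0 : 0 < (φ (ζ ^ 31 * (1 - ζ ^ 9) * (1 - ζ))).re ↔ ¬ (φ (ζ ^ 31 * (1 - ζ ^ 9) * (1 - ζ))).re < 0 :=
    ⟨fun h => not_lt.mpr h.le, fun h => lt_of_le_of_ne (not_lt.mp h) kB.2.1.symm⟩
  have hdec : ∀ s : ZMod 36, s.val.Coprime 36 →
      ((¬ (36 < 4 * s.val % (2 * 36) ↔ 36 < 2 * s.val % (2 * 36)) ∧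
          (36 < 9 * s.val % (2 * 36) ↔ 36 < 1 * s.val % (2 * 36))) ∨
        ((36 < 4 * s.val % (2 * 36) ↔ 36 < 2 * s.val % (2 * 36)) ∧
          ¬ (36 < 9 * s.val % (2 * 36) ↔ 36 < 1 * s.val % (2 * 36))) ↔
        s ∈ ({5, 7, 11, 17, 19, 25, 29, 31} : Finset (ZMod 36))) := by
    decide
  rw [map_mul, Complex.mul_re, kA.2.2, kB.2.2, mul_zero, sub_zero, mul_neg_iff, hA0, hB0, kA.1, kB.1]
  exact hdec t ht

/-- **`X_A = N_odd ∆ A = {1, 5, 11, 13, 17, 29}` at level `36`** for `A = {5, 7, 11, 17, 19, 25, 29, 31}` (`decide`;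
`|X ∖ N_K| = 5` for `N_K = {7, 11, 19, 23, 31, 35}`, so `|S_Φ ∩ X| ≡ 5 + 3 ≡ 0` on the `ℚ(i)`-balanced types).
research route conditional on HC_CM; not a corollary; Q11.4-sentence-2 already refuted in dim ≥ 3. [folklore] -/
theorem twistSetA_thirtySix_AB :
    XA36 ({5, 7, 11, 17, 19, 25, 29, 31} : Finset (ZMod 36)) = ({1, 5, 11, 13, 17, 29} : Finset (ZMod 36)) := by
  decide

omit [NumberField K] in
/-- **`π_Aπ_B = −1 + 2ζ³ − 2ζ⁷ + 2ζ⁸ − ζ⁹ − 2ζ¹⁰ + 2ζ¹¹ =: ϖ_AB`** (reduction modulo `Φ₃₆(ζ) = ζ¹² − ζ⁶ + 1 = 0`; the short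
form is part 116's reference parameter). research route conditional on HC_CM; not a corollary; Q11.4-sentence-2 already refuted in dim ≥ 3. [folklore] -/
theorem prodAB_eq (hζ : IsPrimitiveRoot ζ 36) : ζ ^ 33 * (1 - ζ ^ 4) * (1 - ζ ^ 2) * (ζ ^ 31 * (1 - ζ ^ 9) * (1 - ζ)) = (-1 + 2 * ζ ^ 3 - 2 * ζ ^ 7 + 2 * ζ ^ 8 - ζ ^ 9 - 2 * ζ ^ 10 + 2 * ζ ^ 11) := by
  have h36 : ζ ^ 36 = 1 := hζ.pow_eq_one
  have hΦ : ζ ^ 12 - ζ ^ 6 + 1 = 0 := by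
    have h18 : ζ ^ 18 - 1 ≠ 0 := sub_ne_zero.mpr (hζ.pow_ne_one_of_pos_of_lt (by norm_num) (by norm_num))
    have h12 : ζ ^ 12 ≠ 1 := hζ.pow_ne_one_of_pos_of_lt (by norm_num) (by norm_num)
    have h6 : ζ ^ 6 + 1 ≠ 0 := fun h => h12 (by linear_combination (ζ ^ 6 - 1) * h)
    have h : (ζ ^ 18 - 1) * (ζ ^ 6 + 1) * (ζ ^ 12 - ζ ^ 6 + 1) = 0 := by linear_combination h36
    rcases mul_eq_zero.mp h with h' | h'
    · exact absurd h' (mul_ne_zero h18 h6)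
    · exact h'
  linear_combination (1 - ζ + ζ^2 - ζ^3 - ζ^4 + ζ^5 + ζ^10 - ζ^11 - ζ^12 + ζ^13 - ζ^14 + ζ^15 + 2 * ζ^16 - 2 * ζ^17 -
    ζ^18 + ζ^19 - ζ^20 + ζ^21 + ζ^22 - ζ^23) * hΦ +
    (-ζ + ζ^2 + ζ^3 - ζ^4 + ζ^5 - ζ^6 - ζ^7 + ζ^8 + ζ^28 - ζ^29 - ζ^30 + ζ^31 - ζ^32 + ζ^33 + ζ^34 -
    ζ^35 - ζ^37 + ζ^38 + ζ^39 - ζ^40 + ζ^41 - ζ^42 - ζ^43 + ζ^44) * h36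

omit [NumberField K] in
/-- The integer `Π_A·Π_B` of `𝓞 K` coerces to `π_Aπ_B`. [folklore] -/
theorem coe_gen_AB (hζ : IsPrimitiveRoot ζ 36) :
    (((hζ.toInteger ^ 33 * (1 - hζ.toInteger ^ 4) * (1 - hζ.toInteger ^ 2) * (hζ.toInteger ^ 31 * (1 - hζ.toInteger ^ 9) * (1 - hζ.toInteger)) : 𝓞 K)) : K) = ζ ^ 33 * (1 - ζ ^ 4) * (1 - ζ ^ 2) * (ζ ^ 31 * (1 - ζ ^ 9) * (1 - ζ)) := by
  push_cast
  rfl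

omit [NumberField K] in
/-- The integer `Π_A·Π_B` of `𝓞 K` coerces to `ϖ_AB` (the reduced form). [folklore] -/
theorem coe_gen_AB' (hζ : IsPrimitiveRoot ζ 36) : (((hζ.toInteger ^ 33 * (1 - hζ.toInteger ^ 4) * (1 - hζ.toInteger ^ 2) * (hζ.toInteger ^ 31 * (1 - hζ.toInteger ^ 9) * (1 - hζ.toInteger)) : 𝓞 K)) : K) = (-1 + 2 * ζ ^ 3 - 2 * ζ ^ 7 + 2 * ζ ^ 8 - ζ ^ 9 - 2 * ζ ^ 10 + 2 * ζ ^ 11) := by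
  rw [coe_gen_AB hζ, prodAB_eq hζ]

/-! ### §2 EXISTENCE of the type `(π_Aπ_B)` on every `ℚ(i)`-balanced CM type -/

open scoped Classical in
/-- **ROW `(ℚ(ζ₃₆), ℚ(i))` — THE PRODUCT TYPE `𝔮₃𝔮₂` EXISTS** (→ **R3 = `(3, ℚ(i), 3)`**, part 116): for every CM type `Φ` of
`ℚ(ζ₃₆)` balanced for `N_K = {7, 11, 19, 23, 31, 35}` (`K = ℚ(i)`, the YES row for principal polarisations) and every `𝔣₀`
with `𝔬𝔣₀ = (π_Aπ_B)`, the principal CM torus `ℂ^Φ/Φ(ℤ[ζ₃₆])` carries a `Φ`-positive divisor of type `(K; Φ; 𝔣₀)` (degree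
`N(𝔣₀) = 3·8 = 24`).  Proof: part 53 `exists_type_of_even'` with §1's sign dictionary + THEOREM L (ii) at `36`
(`exists_units_sign_eq_thirtySix`) + `|S_Φ ∩ X| ≡ |X ∖ N_K| + 3 = 5 + 3 ≡ 0` (part 48 `card_inter_mod_two_eq`).
research route conditional on HC_CM; not a corollary; Q11.4-sentence-2 already refuted in dim ≥ 3. [cite: Shimura1998, §14.3 Prop. 4–5, pp. 103–104] -/
theorem exists_type_thirtySixAB_sqrt_neg_one [IsCMField K] [IsCyclotomicExtension {36} ℚ K]
    (hζ : IsPrimitiveRoot ζ 36) (Φ : CMType K)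
    (hbal : 2 * (SΦ[Φ, ζ] ∩ ({7, 11, 19, 23, 31, 35} : Finset (ZMod 36))).card = (SΦ[Φ, ζ]).card)
    {𝔣₀ : Ideal (𝓞 (maximalRealSubfield K))}
    (h𝔣₀ : 𝔣₀.map (algebraMap (𝓞 (maximalRealSubfield K)) (𝓞 K)) = Ideal.span {(hζ.toInteger ^ 33 * (1 - hζ.toInteger ^ 4) * (1 - hζ.toInteger ^ 2) * (hζ.toInteger ^ 31 * (1 - hζ.toInteger ^ 9) * (1 - hζ.toInteger)) : 𝓞 K)}) :
    ∃ ζ' : K, IsCMField.complexConj K ζ' = -ζ' ∧ (∀ φ : Φ.1, 0 < (φ.1 ζ').im) ∧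
        CMTypeLattice.IsOfType (1 : (FractionalIdeal (𝓞 K)⁰ K)ˣ) ζ' 𝔣₀ := by
  have hg : Nat.totient 36 = 2 * (5 + 1) := by decide
  obtain ⟨hA, hreal, h0⟩ := signSet_thirtySix_AB hζ
  have hP := coe_gen_AB hζ
  refine exists_type_of_even' hζ hg hreal h0 hP hA Φ h𝔣₀ (exists_units_sign_eq_thirtySix hζ Φ) ?_
  rw [twistSetA_thirtySix_AB]
  have hS := isCMTypeSet_residueFilter hζ Φ
  have hX : IsCMTypeSet 36 ({1, 5, 11, 13, 17, 29} : Finset (ZMod 36)) := by decide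
  have hNK : IsCMTypeSet 36 ({7, 11, 19, 23, 31, 35} : Finset (ZMod 36)) := by decide
  have h1 := card_inter_mod_two_eq hS hX hNK
  have h2 := two_mul_card_eq_card_units hS
  have hU : (Finset.univ.filter fun t : ZMod 36 => t.val.Coprime 36).card = 12 := by decide
  have h3 : (({1, 5, 11, 13, 17, 29} : Finset (ZMod 36)) \ ({7, 11, 19, 23, 31, 35} : Finset (ZMod 36))).card = 5 := by
    decide
  rw [Nat.even_iff]
  omega

/-- **`∃ 𝔣₀ ⊆ 𝓞 K⁺` with `𝔬𝔣₀ = (π_Aπ_B)`** (the product is real: part 53 `exists_ideal_map_eq_span`), so the row theorem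
is not vacuous. research route conditional on HC_CM; not a corollary; Q11.4-sentence-2 already refuted in dim ≥ 3. [cite: Shimura1998, §14.3, p. 103] -/
theorem exists_type_ideal_thirtySixAB [IsCMField K] (hζ : IsPrimitiveRoot ζ 36) :
    ∃ 𝔣₀ : Ideal (𝓞 (maximalRealSubfield K)),
      𝔣₀.map (algebraMap (𝓞 (maximalRealSubfield K)) (𝓞 K)) = Ideal.span {(hζ.toInteger ^ 33 * (1 - hζ.toInteger ^ 4) * (1 - hζ.toInteger ^ 2) * (hζ.toInteger ^ 31 * (1 - hζ.toInteger ^ 9) * (1 - hζ.toInteger)) : 𝓞 K)} := by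
  obtain ⟨-, hreal, -⟩ := signSet_thirtySix_AB hζ
  exact exists_ideal_map_eq_span (coe_gen_AB hζ) hreal

end Summit.HodgeConjecture.Ring2WeilCoverage.WeilGramLevel36TypeABExists

end
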